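/-
Copyright: the b2b-balaban T⁴-continuum CRUX team, row NE7b leaf lineage `t4-ne7b-formalise-leaf-03` (gen 153). Project licence.
-/
import Summits.QuantumFields.BalabanUV.T4Continuum.Spine.NE7b.FibreSupUniqueness
import Summits.QuantumFields.BalabanUV.T4Continuum.Spine.NE7b.FibreInverseSupNorm
import Summits.QuantumFields.BalabanUV.T4Continuum.Spine.NE7b.OneShotChartSupSharp
import Literature.MathematicalPhysics.QuantumFieldTheory.Balaban1983to89.Beta.EntrywiseVolumeLimit

/-!
# THE ONE-SHOT SECTION IS THE UNIQUE BOUNDED BLOCK-HARMONIC INTERPOLANT, AND A PERIODIC ONE IS ITS PERIODISATION: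
# a bounded fine field on `ℤ^d` whose block means are the bounded coarse field `k` and whose lattice Laplacian is constant on
# every block IS `H k = Σ′_y k(y)H(·,y)`; for the `s`-periodic indicator data `k = 1_{w + sℤ^d}` it IS the image series
# `Σ′_m H(·, w + s·m)` — the identification «periodic constrained-minimiser column = periodised `ℤ^d` kernel» (row NE7b, node U5c;
# PRICING-NE7b v124 F733 (e3) ∕ F744 (c) (iii), the OWNER's (54) HONEST clause; (52) `FibreSupUniqueness.augmented_unique` +
# (51) `FibreInverseSupNorm.sum_B_HBZd_of_bounded` ∕ `sum_AX_HBZd` + SUPSHARP `abs_HBZd_le_rowSum` + `Beta.VolumeImages` BY NAME; [folklore])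

Cell `pub-balaban`, sub-cell `t4`, spine estimate NE7b (`T4WeightBudget.RelWeightBound`; the cell's OWN estimate — NOT PRINTED in
[Bałaban 1983–89], NOT PROVED).  Crux-route work under `Spine/NE7b/` by leaf-03 (CRUX team (2), FREEZE (0) crux-prover clause, gen 153).
NOTHING of Bałaban's is asserted; no `T4Continuum/Support` leaf; no `def`; zero `sorry`.  EVERY `d`, every block side `n + 1`, every `a > 0`.

WHY (located).  The tree knows the one-shot section `H = G′Q′*(Q′G′Q′*)⁻¹` of [B5] (1.103) on `ℤ^d` column by column (`kerH`) and on
`ℓ²` ∕ `ℓ^∞` data (`HBZd`); (52) proved LIOUVILLE in `ℓ^∞` (a bounded field with block-constant `Aφ` and zero block sums vanishes) and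
(51) that `H k` solves the augmented system for bounded `k`.  What no file states is the converse reading every torus computation needs:
ANY bounded field with the right block means and a block-constant LAPLACIAN (the `a`-free Euler–Lagrange condition «harmonic modulo
block constants») is `H k` — in particular a periodic solution of the finite-torus KKT system, extended periodically, is the periodised
kernel.  This is the «identification (e3)» the pricing desk lists as the untyped ingredient of the kernel NEGATIVE sup letter
NL-NE7b-2° (v124 F744 (c)) and the clause the OWNER's (54) `OneShotChartTorusRows` leaves open («the periodised kernel is NOT identified
with a torus-side constrained minimiser»).  This file types it WITHOUT a torus object: the torus enters only through periodic data.

WHAT IS PROVED ([folklore]; `n : ℕ`, `a > 0`, every `d`):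
* §1 `abs_HBZd_le_mesh` — `|(Hk)(p)| ≤ R·c_H·√((n+1)^d)·K_d(δ_H)`, a bound uniform in `p` (leaf-03's SUPSHARP `abs_HBZd_le_rowSum` +
  `B5Hk165L2Zd.abs_kerH_row`; the mesh factor is immaterial for uniqueness).
* §2 `sum_nbhd_AX_mul_eq` — the site matrix `A = (n+1)²(−Δ) + a(n+1)^{−d}·1[same block]` against a field with block sums `(n+1)^d·k`:
  `Σ_r A(p,r)φ(r) = (n+1)²·Σ_μ(2φ(p) − φ(p+e_μ) − φ(p−e_μ)) + a·k(blk p)` (`B6QGQFourier275Zd.sum_nbhd_sameBlk_mul` for the `Q′*Q′` part).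
* §3 **`eq_HBZd_of_blockHarmonic`**: `|φ| ≤ M`, `|k| ≤ R`, `Σ_{B(z)}φ = (n+1)^d k(z)` for all `z`, and the Laplacian three-point sums
  `Σ_μ(2φ(p) − φ(p+e_μ) − φ(p−e_μ)) = c(blk p)` block-constant ⟹ **`φ = HBZd n a k`**; **`eq_HBZd_of_blockHarmonic'`** — the same with
  block-constancy stated as `blk p = blk p′ → (−Δφ)(p) = (−Δφ)(p′)` (no multiplier to exhibit).
* §4 periodic data: `mem_range_imageShift_iff` (`z ∈ w + sℤ^d ↔ s ∣ z_i − w_i`), `HBZd_indicator_images` — for `k = 1_{w + sℤ^d}`,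
  `(Hk)(p) = Σ′_m H(p, w + s·m)` (the image series of (54)); **`images_eq_of_blockHarmonic`** — a bounded field with block sums
  `(n+1)^d·1_{w + sℤ^d}` and block-constant Laplacian IS that image series: THE PERIODIC KKT SOLUTION IS THE PERIODISED KERNEL.
* §5 toy.

HONEST: [folklore] bookkeeping over (51)∕(52); no torus object is defined (a torus certificate enters a consumer file as a periodic field
on `ℤ^d`); nothing of the covariant `H_k`, (A3) ∕ NC-NE7b-α UNRULED.  BY-NAME EFFECT ON THE WALL: NONE.  NE7b NOT PRINTED ∕ NOT PROVED;
spine PROVED 0∕9; rung (B)+1 on a FINITE torus — NOT infinite volume, NOT the mass gap, NOT Clay.  HONEST DEPENDENCY: continuum YM on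
T⁴ ⇐ BetaPertH ∧ nine spine estimates (0∕9 proved); BetaPertH ⇐ (D1) ∧ (D4) ∧ CAP+tail; G-an2-4 gates asym, D1 and NE2∕3∕4.
-/

set_option autoImplicit false

namespace Summit.QuantumFields.BalabanUV.T4Continuum.NE7b.OneShotChartBoundedUniqueness

open Finset Real
open Literature.MathematicalPhysics.QuantumFieldTheory.Balaban1983to89
open B4Sect5Proof (latticeConst latticeConst_nonneg)
open B6QGQLower276 (X e blk B mem_B sum_B_const AX chart blk_chart lapKer sameBlk)
open B5Hk103ScalarZd (kerH Kinv nbhd tsum_AX_mul tsum_lapKer_mul lapKer_eq_zero_of_not_mem cH deltaH)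
open B5Hk165L2Zd (HBZd abs_kerH_row)
open B6QGQFourier275Zd (sum_nbhd_sameBlk_mul)
open OneShotChartSupNorm (nonneg_of_abs_le)
open OneShotChartSupSharp (abs_HBZd_le_rowSum)
open FibreSupUniqueness (augmented_unique)
open FibreInverseSupNorm (sum_B_HBZd_of_bounded sum_AX_HBZd)

noncomputable section

variable {d : ℕ}

/-! ## §1. `H` on bounded data is bounded (every `d`; the mesh factor is irrelevant for uniqueness) -/

/-- `|(Hk)(p)| ≤ R·(c_H·√((n+1)^d)·K_d(δ_H))` — a bound UNIFORM IN `p` (every `d`; `B5Hk165L2Zd.abs_kerH_row`). [folklore] -/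
theorem abs_HBZd_le_mesh (n : ℕ) {a : ℝ} (ha : 0 < a) {k : X d → ℝ} {R : ℝ} (hk : ∀ y, |k y| ≤ R) (p : X d) :
    |HBZd n a k p| ≤ R * (cH d a * Real.sqrt (((n : ℝ) + 1) ^ d) * latticeConst d (deltaH d a)) :=
  (abs_HBZd_le_rowSum n ha hk p).trans (mul_le_mul_of_nonneg_left (abs_kerH_row n ha p).2 (nonneg_of_abs_le hk))

/-! ## §2. The site matrix against a field with prescribed block sums -/

/-- The Laplacian part of a row of `A` over the window is the three-point sum. [folklore] -/
theorem sum_nbhd_lapKer_mul (n : ℕ) (p : X d) (φ : X d → ℝ) :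
    ∑ r ∈ nbhd n p, lapKer p r * φ r = ∑ μ, (2 * φ p - φ (p + e μ) - φ (p - e μ)) := by
  rw [← tsum_lapKer_mul p φ]
  exact (tsum_eq_sum (s := nbhd n p) (fun r hr => by rw [lapKer_eq_zero_of_not_mem (n := n) hr, zero_mul])).symm

/-- **A row of `A = (n+1)²(−Δ) + a(n+1)^{−d}·1[same block]` against `φ` with block sums `(n+1)^d·k`:**
`Σ_{r∈nbhd p} A(p,r)φ(r) = (n+1)²·Σ_μ(2φ(p) − φ(p+e_μ) − φ(p−e_μ)) + a·k(blk p)`. [folklore] -/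
theorem sum_nbhd_AX_mul_eq (n : ℕ) (a : ℝ) {φ k : X d → ℝ} (hQ : ∀ z : X d, ∑ p ∈ B n z, φ p = ((n : ℝ) + 1) ^ d * k z)
    (p : X d) :
    ∑ r ∈ nbhd n p, AX n a p r * φ r
      = ((n : ℝ) + 1) ^ 2 * ∑ μ, (2 * φ p - φ (p + e μ) - φ (p - e μ)) + a * k (blk n p) := by
  have hN : ((n : ℝ) + 1) ^ d ≠ 0 := by positivity
  have hsplit : ∀ r, AX n a p r * φ r
      = ((n : ℝ) + 1) ^ 2 * (lapKer p r * φ r) + a / ((n : ℝ) + 1) ^ d * (sameBlk n p r * φ r) := by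
    intro r; rw [AX]; ring
  rw [Finset.sum_congr rfl fun r _ => hsplit r, Finset.sum_add_distrib, ← Finset.mul_sum, ← Finset.mul_sum,
    sum_nbhd_lapKer_mul n p φ, sum_nbhd_sameBlk_mul n p φ, hQ (blk n p)]
  field_simp

/-! ## §3. THE ONE-SHOT SECTION IS THE UNIQUE BOUNDED BLOCK-HARMONIC INTERPOLANT -/

/-- **UNIQUENESS OF THE BOUNDED BLOCK-HARMONIC INTERPOLANT** (every `d`, every side, every `a > 0`): a bounded fine field `φ` whose
block sums are `(n+1)^d·k` (bounded coarse data `k`) and whose lattice Laplacian `Σ_μ(2φ(p) − φ(p+e_μ) − φ(p−e_μ))` is CONSTANT ON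
EVERY BLOCK (value `c(blk p)`) is the one-shot section: `φ = H k`.  (Liouville (52) for `φ − Hk`; `Hk` solves the system by (51).) [folklore] -/
theorem eq_HBZd_of_blockHarmonic (n : ℕ) {a : ℝ} (ha : 0 < a) {k : X d → ℝ} {R : ℝ} (hk : ∀ y, |k y| ≤ R)
    {φ : X d → ℝ} {M : ℝ} (hφ : ∀ r, |φ r| ≤ M) (c : X d → ℝ)
    (hΔ : ∀ p : X d, ∑ μ, (2 * φ p - φ (p + e μ) - φ (p - e μ)) = c (blk n p))
    (hQ : ∀ z : X d, ∑ p ∈ B n z, φ p = ((n : ℝ) + 1) ^ d * k z) : φ = HBZd n a k := by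
  refine augmented_unique n ha (ψ := fun _ => 0) (c₁ := fun y => ((n : ℝ) + 1) ^ 2 * c y + a * k y)
    (c₂ := fun y => ∑' y', k y' * Kinv n a y y') hφ (fun r => abs_HBZd_le_mesh n ha hk r) ?_ ?_ ?_
  · intro p; rw [sum_nbhd_AX_mul_eq n a hQ p, hΔ p, zero_add]
  · intro p; rw [sum_AX_HBZd n ha hk p, zero_add]
  · intro z; rw [hQ z, sum_B_HBZd_of_bounded n ha hk z]

/-- **The same, with block-constancy as an equality between block-mates** (no multiplier to exhibit):
`blk p = blk p′ ⟹ (−Δφ)(p) = (−Δφ)(p′)`, block sums `(n+1)^d·k`, `φ` and `k` bounded ⟹ `φ = H k`. [folklore] -/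
theorem eq_HBZd_of_blockHarmonic' (n : ℕ) {a : ℝ} (ha : 0 < a) {k : X d → ℝ} {R : ℝ} (hk : ∀ y, |k y| ≤ R)
    {φ : X d → ℝ} {M : ℝ} (hφ : ∀ r, |φ r| ≤ M)
    (hΔ : ∀ p p' : X d, blk n p = blk n p' →
      ∑ μ, (2 * φ p - φ (p + e μ) - φ (p - e μ)) = ∑ μ, (2 * φ p' - φ (p' + e μ) - φ (p' - e μ)))
    (hQ : ∀ z : X d, ∑ p ∈ B n z, φ p = ((n : ℝ) + 1) ^ d * k z) : φ = HBZd n a k :=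
  eq_HBZd_of_blockHarmonic n ha hk hφ (fun y => ∑ μ, (2 * φ (chart n y 0) - φ (chart n y 0 + e μ) - φ (chart n y 0 - e μ)))
    (fun p => hΔ p (chart n (blk n p) 0) (by rw [blk_chart])) hQ

/-- Pointwise form. [folklore] -/
theorem eq_HBZd_of_blockHarmonic_apply (n : ℕ) {a : ℝ} (ha : 0 < a) {k : X d → ℝ} {R : ℝ} (hk : ∀ y, |k y| ≤ R)
    {φ : X d → ℝ} {M : ℝ} (hφ : ∀ r, |φ r| ≤ M)
    (hΔ : ∀ p p' : X d, blk n p = blk n p' →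
      ∑ μ, (2 * φ p - φ (p + e μ) - φ (p - e μ)) = ∑ μ, (2 * φ p' - φ (p' + e μ) - φ (p' - e μ)))
    (hQ : ∀ z : X d, ∑ p ∈ B n z, φ p = ((n : ℝ) + 1) ^ d * k z) (p : X d) :
    φ p = ∑' y : X d, k y * kerH n a p y := by
  have h := eq_HBZd_of_blockHarmonic' n ha hk hφ hΔ hQ
  rw [h, HBZd]

/-! ## §4. Periodic data: the periodic block-harmonic interpolant IS the periodised kernel -/

/-- `z ∈ w + sℤ^d ↔ s ∣ z_i − w_i` for every `i`. [folklore] -/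
theorem mem_range_imageShift_iff (s : ℕ) (w z : X d) :
    z ∈ Set.range (Beta.imageShift s w) ↔ ∀ i, (s : ℤ) ∣ z i - w i := by
  constructor
  · rintro ⟨m, rfl⟩ i
    exact ⟨m i, by rw [Beta.imageShift_apply]; ring⟩
  · intro h
    choose m hm using h
    refine ⟨m, funext fun i => ?_⟩
    rw [Beta.imageShift_apply]
    have := hm i
    linarith

/-- The indicator of `w + sℤ^d` is bounded by `1`. [folklore] -/
theorem abs_indicator_range_le_one (s : ℕ) (w y : X d) :
    |Set.indicator (Set.range (Beta.imageShift s w)) (fun _ => (1 : ℝ)) y| ≤ 1 := by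
  by_cases hy : y ∈ Set.range (Beta.imageShift s w)
  · rw [Set.indicator_of_mem hy, abs_one]
  · rw [Set.indicator_of_notMem hy, abs_zero]; exact zero_le_one

/-- **`H` on the periodic indicator `1_{w + sℤ^d}` is the image series**: `(H 1_{w+sℤ^d})(p) = Σ′_m H(p, w + s·m)` (`s ≥ 1`; the series
of the OWNER's (54) `OneShotChartTorusRows`). [folklore] -/
theorem HBZd_indicator_images (n : ℕ) (a : ℝ) (s : ℕ) [NeZero s] (w p : X d) :
    HBZd n a (Set.indicator (Set.range (Beta.imageShift s w)) (fun _ => (1 : ℝ))) p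
      = ∑' m : X d, kerH n a p (Beta.imageShift s w m) := by
  rw [HBZd]
  have hinj : Function.Injective (Beta.imageShift s w) := Beta.imageShift_injective s w
  have hsupp : Function.support (fun y : X d =>
      Set.indicator (Set.range (Beta.imageShift s w)) (fun _ => (1 : ℝ)) y * kerH n a p y) ⊆ Set.range (Beta.imageShift s w) := by
    intro y hy
    by_contra hy'
    apply hy
    show Set.indicator (Set.range (Beta.imageShift s w)) (fun _ => (1 : ℝ)) y * kerH n a p y = 0
    rw [Set.indicator_of_notMem hy', zero_mul]
  rw [← hinj.tsum_eq hsupp]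
  refine tsum_congr fun m => ?_
  show Set.indicator (Set.range (Beta.imageShift s w)) (fun _ => (1 : ℝ)) (Beta.imageShift s w m) * _ = _
  rw [Set.indicator_of_mem (Set.mem_range_self m), one_mul]

/-- **THE PERIODIC KKT SOLUTION IS THE PERIODISED KERNEL** (every `d`, every side `n + 1`, every coarse period `s ≥ 1`, every `a > 0`):
a bounded fine field `φ` with block sums `(n+1)^d·1_{w + sℤ^d}` and block-constant Laplacian satisfies `φ(p) = Σ′_m H(p, w + s·m)` for
every `p` — the torus constrained-minimiser column (any exact finite certificate of it, extended periodically) identified with the image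
series of the `ℤ^d` one-shot kernel. [folklore] -/
theorem images_eq_of_blockHarmonic (n : ℕ) {a : ℝ} (ha : 0 < a) (s : ℕ) [NeZero s] (w : X d)
    {φ : X d → ℝ} {M : ℝ} (hφ : ∀ r, |φ r| ≤ M)
    (hΔ : ∀ p p' : X d, blk n p = blk n p' →
      ∑ μ, (2 * φ p - φ (p + e μ) - φ (p - e μ)) = ∑ μ, (2 * φ p' - φ (p' + e μ) - φ (p' - e μ)))
    (hQ : ∀ z : X d, ∑ p ∈ B n z, φ p
      = ((n : ℝ) + 1) ^ d * Set.indicator (Set.range (Beta.imageShift s w)) (fun _ => (1 : ℝ)) z) (p : X d) :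
    ∑' m : X d, kerH n a p (Beta.imageShift s w m) = φ p := by
  rw [← HBZd_indicator_images n a s w p, ← eq_HBZd_of_blockHarmonic' n ha (abs_indicator_range_le_one s w) hφ hΔ hQ]

/-! ## §5. Toy -/

/-- Toy (`d = 0`, one site, one block): the only field with block sum `k` is the constant `k`, and the statement degenerates correctly —
here only the arithmetic shell `(0+1)^0·k = k` is exercised. -/
example (k : ℝ) : ((0 : ℝ) + 1) ^ 0 * k = k := by norm_num

end

end Summit.QuantumFields.BalabanUV.T4Continuum.NE7b.OneShotChartBoundedUniqueness
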